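import Summits.BirchSwinnertonDyer.BirchSwinnertonDyer.Theorems.KolyvaginDepthDoorDepthTableLambdaJoinRows
import Summits.BirchSwinnertonDyer.Rank1Residual.X11b.Three.KolyvaginNonvanishing
import HarnessLib

/-!
# Route `KolyvaginDepthDoor` — the λ-side prediction made ROW-SPECIFIC: at the depth table's OWN
# Heegner field `K`, `t_p = 0` + `s_p(E^{(d_K)}) ≤ 1` forces a non-zero class on ONE Kolyvagin prime
# for `K` (W. Zhang 2014 Thm. 1.1 in place of BCGS; crux `KolyvaginDepthSupply`, stmt-BirchSwinnertonDyer-21765)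

Helper file (`--supports stmt-BirchSwinnertonDyer-21765 --as helper`); it closes nothing and BSD is
not proved by it. HONEST FRAMING: per-curve theorems, CONDITIONAL on two XL named facts — W. Zhang
2014 Thm. 1.1 at `N⁻ = 1` (`WZhang2014_exists_kolyvaginClass_one_ne_zero`, Kolyvagin's conjecture)
and Kolyvagin 1991 Thm. 4 (`hF`, the route's support item) — and, in the atlas form, on
Perrin-Riou–Schneider, Kato 17.4 and the modular-symbol DATA; plus ONE analytic datum on the twist
(`s_p(E^{(d_K)}) ≤ 1`, i.e. `ord_{s=1} L(E^{(d_K)}, s) ≤ 1` through GZK — the depth table's own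
field-selection criterion, NOT proved here).

WHY THIS FILE. `KolyvaginDepthDoorDepthTableLambdaJoin(Rows)` predicts the depth table's bit from the
cyclotomic certificate for SOME admissible Heegner field `K` with `p` SPLIT in `K` (the hypothesis of
the tree's BCGS 2026 fact, supplied by Bump–Friedberg–Hoffstein). But 12 of the 18 depth-table rows
(g2, `C<label>.depthRow_p_negD_ℓ`) sit at a field in which `p` is INERT (`(d_K/5) = −1` for
`d_K ∈ {−7, −8, −23, −83, −52, −67}`, `(−51/7) = −1`), outside BCGS's letter. W. Zhang's Thm. 1.1 (tree
fact, `N⁻ = 1` transcription) has NO splitting condition on `p`: its hypotheses are `p ≥ 5` good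
ordinary, `ρ̄_{E,p}` onto, Hypothesis ♠ (at `N⁻ = 1`: every multiplicative `ℓ` has
`p ∤ v_ℓ(Δ_min)`; two multiplicative primes if not semistable), `K` Heegner with `p ∤ d_K`. For the 15
SEMISTABLE depth-table curves ♠ holds at the row's `p` (all `v_ℓ(Δ_min) ∈ {1, 2, 4}`) and is proved
here from the integer model; the 3 curves additive at `2` (`664a1`, `916c1`, `944e1`: one
multiplicative prime only) are outside ♠(2).

* `not_dvd_padicValInt_of_intModel` — ♠(1) from an integer model: prime-power exponents of `Δ(E₀)`.
* `exists_kolyvaginPrime_class_ne_zero_at_of_shaCorank_eq_zero` — **row-specific supply.** `W`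
  globally minimal of rank `2`; `p ≥ 5` good ordinary, `ρ̄` onto, ♠; `K` Heegner (`d_K ∉ {−3,−4}`,
  `p ∤ d_K`); `s_p(E^{(d_K)}) ≤ 1`; `t_p(E) = 0`. THEN for THIS `K`: a frame, a Kolyvagin PRIME `ℓ`
  for `(E, K, p)`, a level `1 ≤ M ≤ M(ℓ)` and a datum with `c_M(ℓ) ≠ 0`, no non-zero class of the
  system at depth `0`, and `rank E^{(d_K)} < rank E` (Zhang: some `c_1(n) ≠ 0`; Kolyvagin's
  dichotomy at the depth-minimiser with `s_p(E) = 2`, `s_p(E^K) ≤ 1` leaves `ν₀ = 1`; Kummer).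
* `exists_kolyvaginPrime_class_ne_zero_at_of_atlasCell` — the same with `t_p = 0` and `rank = 2`
  read off a cell of the tree's `p`-adic atlas (`AtlasCurve.padicRow`).
* `C389a1.spade_5` — ♠(1) at `5` and semistability for `389a1`, kernel-decided (the other 14 semistable
  rows: sequel `KolyvaginDepthDoorDepthTableLambdaRowPredictionSpade`, `C<label>.spade_p`);
  `C389a1.exists_kolyvaginPrime_class_ne_zero_of_lambda_at` — the showcase composed at
  `(389a1, 5, d_K = −7)`: atlas cell + `s_5(E^{(−7)}) ≤ 1` ⟹ some Kolyvagin prime `ℓ` FOR `ℚ(√−7)`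
  carries `c_M(ℓ) ≠ 0` — the field of g2's row `C389a1.depthRow_5_neg7_19` (`ℓ = 19` there; here
  `∃ ℓ`). The other 14 rows compose identically (`spade` + g2's surjectivity + the atlas cell).

AGREEMENT READING: for a semistable depth-table row `(E, p, K, ℓ₁ < ℓ₂ < ℓ₃)` the cyclotomic
certificate now predicts — modulo {Zhang 1.1, Kolyvagin Thm. 4, PRS, Kato, symbol data, `r_an(E^K) ≤ 1`}
— a non-zero class at SOME Kolyvagin prime of the SAME field `K`; a Jetchev–Lauter–Stein run finding
`P(ℓ) ∈ p·E(K[ℓ])` at every Kolyvagin `ℓ` up to a bound does not contradict it (the prediction is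
`∃ ℓ`), but a non-zero find at any `ℓ` confirms both doors at once. BSD is not proved by any of this.

References: [WZhang2014] Thm. 1.1 (p. 195), Hypothesis ♠ (pp. 194–195), Notations (xii);
[Kolyvagin1991MathAnn] §2 Thm. 4; [BurungaleEtAl2026] Thm. 1 (the split-`p` sibling);
[SteinWuthrich2013] Thm. 1.1, §3; [GreenbergLNM1716] §1; [CremonaAlgorithms1997] Table 1.
-/

set_option linter.dupNamespace false

noncomputable section

open scoped Classical NumberField

namespace Summit.BirchSwinnertonDyer.BirchSwinnertonDyer.Theorems.KolyvaginDepthDoor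

open Literature.NumberTheory.EllipticCurves Literature.NumberTheory.EllipticCurves.ModularForms
  WeierstrassCurve CongruenceSubgroup
open Summit.BirchSwinnertonDyer.BirchSwinnertonDyer.Theorems
open Summit.BirchSwinnertonDyer.BirchSwinnertonDyer.Rank2Observatory
open Summit.BirchSwinnertonDyer.BirchSwinnertonDyer.Rank1Residual

/-! ## §1 Hypothesis ♠(1) from an integer model -/

section Generic

variable {W : WeierstrassCurve ℚ} [W.IsElliptic] [W.IsGloballyMinimal] {E₀ : WeierstrassCurve ℤ}
  (hI : integralModelInt W = E₀)
include hI

/-- **♠(1) read off the integer model.** For the globally minimal `W` with integral model `E₀`: if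
every prime `q ∣ Δ(E₀)` has `qᵉ ∥ Δ(E₀)` with `p ∤ e`, then `ρ̄_{E,p}` is ramified at every
multiplicative prime `ℓ` in W. Zhang's sense, `p ∤ v_ℓ(Δ_min)` (multiplicative ⇒ bad ⇒ `ℓ ∣ N_E` ⇒
`ℓ ∣ Δ(E₀) = Δ_min`). [cite: WZhang2014, Hypothesis ♠ (1) (pp. 194–195)]
[cite: SilvermanAEC2009, VII.5 Prop. 5.1] -/
theorem not_dvd_padicValInt_of_intModel (p : ℕ) [Fact p.Prime]
    (h : ∀ q : ℕ, q.Prime → (q : ℤ) ∣ E₀.Δ →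
      ∃ e : ℕ, (q : ℤ) ^ e ∣ E₀.Δ ∧ ¬ (q : ℤ) ^ (e + 1) ∣ E₀.Δ ∧ ¬ p ∣ e) :
    ∀ (ℓ : ℕ) [Fact ℓ.Prime], W.HasMultiplicativeReductionAtPrime ℓ →
      ¬ p ∣ padicValInt ℓ W.minimalDiscriminantInt := by
  intro ℓ hℓ hmult
  have hbad : ¬ W.HasGoodReductionAtPrime ℓ :=
    WeierstrassCurve.HasMultiplicativeReduction.not_hasGoodReduction (R := ℤ_[ℓ]) hmult
  have hN : ℓ ∣ W.conductorNorm ℤ := (W.dvd_conductorNorm_iff_not_hasGoodReductionAtPrime ℓ).mpr hbad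
  obtain ⟨e, he, he', hpe⟩ := h ℓ hℓ.out (dvd_Δ_of_dvd_conductorNorm hI hℓ.out hN)
  rw [IntModel.minimalDiscriminantInt_eq hI, IntModel.padicValInt_eq_of_dvd_of_not_dvd ℓ he he']
  exact hpe

/-- **Semistability over `ℤ` read off the integer model** (`gcd(c₄, Δ) = 1`; the row kit's
`isSemistable_of_intModel_of_isCoprime` over `𝓞 ℚ`, here in the `ℤ`-form of W. Zhang's ♠(2) binder).
[cite: SilvermanAEC2009, VII.5 Prop. 5.1] -/
theorem isSemistable_int_of_intModel_of_isCoprime (hcop : IsCoprime E₀.c₄ E₀.Δ) :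
    W.IsSemistable ℤ := by
  have hΔ : E₀.Δ ≠ 0 := by
    rw [← IntModel.minimalDiscriminantInt_eq hI]
    exact minimalDiscriminantInt_ne_zero W
  have h : (E₀.baseChange ℚ).IsSemistable ℤ := isSemistable_baseChange_of_isCoprime E₀ hΔ hcop
  rw [← eq_baseChange_of_intModel hI] at h
  exact h

end Generic

/-! ## §2 Row-specific supply at rank `2`: `t_p = 0` and `s_p(E^K) ≤ 1` force a class on ONE Kolyvagin prime for `K` -/

/-- **Row-specific supply (modulo W. Zhang 2014 Thm. 1.1 and Kolyvagin 1991 Thm. 4).** Data: `W/ℚ`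
globally minimal with `rank_ℤ E(ℚ) = 2`; `p ≥ 5` good ordinary with `ρ̄_{E,p}` onto and Hypothesis ♠
(♠(1) `hram`: every multiplicative `ℓ` has `p ∤ v_ℓ(Δ_min)`; ♠(2) `hss`: two multiplicative primes
if not semistable); `K` imaginary quadratic, `d_K ∉ {−3, −4}`, `p ∤ d_K`, Heegner hypothesis for
`N_E` — NO condition on the splitting of `p` in `K`; the twist datum `s_p(E^{(d_K)}) ≤ 1`; and
`corank_ℤ_p Ш(E)[p^∞] = 0`. Conclusion, FOR THIS `K`: a frame `(Dt, β, ι)`, a Kolyvagin PRIME `ℓ`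
for `(E, K, p)`, a level `1 ≤ M ≤ M(ℓ)` and a Kolyvagin–Heegner datum of conductor `ℓ` with
`c_M(ℓ) ≠ 0`; no non-zero class of the system at depth `0`; and `rank E^{(d_K)} < rank E`. Proof:
Zhang gives `c_1(n) ≠ 0` for some `n`; at the depth-minimiser `ν₀` (`exists_minimal_kolyvaginClass_ne_zero`)
Kolyvagin's dichotomy is `{s, s'} ∋ ν₀ + 1` with the other `≤ ν₀`; Kummer with `t_p = 0` gives
`s = 2`, and `s' ≤ 1` kills `s' = ν₀ + 1` (it would force `s ≤ 0`), so `s = ν₀ + 1`, `ν₀ = 1`, `n₀`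
is prime; `rank E^K ≤ s' ≤ 1 < 2`. CONDITIONAL on `hZ`, `hF`; per-curve; BSD is not proved by it.
[cite: WZhang2014, Thm. 1.1 (p. 195) and Notations (xii)] [cite: Kolyvagin1991MathAnn, §2 Thm. 4]
[cite: GreenbergLNM1716, §1 pp. 54–57] -/
theorem exists_kolyvaginPrime_class_ne_zero_at_of_shaCorank_eq_zero
    (hZ : WZhang2014_exists_kolyvaginClass_one_ne_zero)
    (hF : Kolyvagin1991_selmerCorank_of_kolyvaginClass_ne_zero)
    (W : WeierstrassCurve ℚ) [W.IsElliptic] [W.IsGloballyMinimal] (hr : W.mordellWeilRank = 2)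
    (p : ℕ) [hp : Fact p.Prime] (h5 : 5 ≤ p) (hgood : W.HasGoodReductionAtPrime p)
    (hord : ¬ (p : ℤ) ∣ W.frobeniusTrace p) (hsurj : W.HasSurjectiveModNGaloisRep p)
    (hram : ∀ (ℓ : ℕ) [Fact ℓ.Prime], W.HasMultiplicativeReductionAtPrime ℓ →
      ¬ p ∣ padicValInt ℓ W.minimalDiscriminantInt)
    (hss : ¬ W.IsSemistable ℤ → ∃ (ℓ₁ ℓ₂ : ℕ) (_ : Fact ℓ₁.Prime) (_ : Fact ℓ₂.Prime), ℓ₁ ≠ ℓ₂ ∧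
      W.HasMultiplicativeReductionAtPrime ℓ₁ ∧ W.HasMultiplicativeReductionAtPrime ℓ₂)
    (K : Type) [Field K] [NumberField K] (hK : IsImaginaryQuadratic K)
    (h3 : NumberField.discr K ≠ -3) (h4 : NumberField.discr K ≠ -4)
    (hpd : ¬ ((p : ℤ) ∣ NumberField.discr K)) [NeZero (W.conductorNorm ℤ)]
    (hH : SatisfiesHeegnerHypothesis (W.conductorNorm ℤ) K)
    (hc' : (W.quadraticTwist (NumberField.discr K : ℚ)).selmerCorank p ≤ 1)
    (ht : W.shaCorank p = 0) :
    ∃ (Dt : ModularParametrizationData W (W.conductorNorm ℤ)) (β : ℤ) (ι : K →+* ℂ) (ℓ : ℕ)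
      (d : KolyvaginHeegnerData Dt β ι ℓ) (M : ℕ),
      ℓ.Prime ∧ Zhang2014.IsKolyvaginPrime (W.conductorNorm ℤ) W K p ℓ ∧
      1 ≤ M ∧ (M : ℕ∞) ≤ Zhang2014.levelIndex W p ℓ ∧ d.kolyvaginClass hp.out M ≠ 0 ∧
      (∀ (n' : ℕ) (d' : KolyvaginHeegnerData Dt β ι n') (M' : ℕ),
        KolyvaginDescent.KolSupp (Zhang2014.IsKolyvaginPrime (W.conductorNorm ℤ) W K p) n' →
        1 ≤ M' → (M' : ℕ∞) ≤ Zhang2014.levelIndex W p n' → d'.kolyvaginClass hp.out M' ≠ 0 →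
        1 ≤ n'.primeFactors.card) ∧
      (W.quadraticTwist (NumberField.discr K : ℚ)).mordellWeilRank < W.mordellWeilRank := by
  have hpN : ¬ (p ∣ W.conductorNorm ℤ) := fun h' ↦
    (W.dvd_conductorNorm_iff_not_hasGoodReductionAtPrime p).mp h' hgood
  -- W. Zhang: some `c_1(n) ≠ 0` for THIS `K`
  obtain ⟨Dt, β, ι, n₁, d₁, hΛ₁, hlev₁, hne₁⟩ := hZ W p h5 hgood hord hsurj hram hss K hK hH hpd
  -- the depth-minimiser and Kolyvagin's dichotomy there
  obtain ⟨n₀, d₀, M₀, hΛ₀, hM₀, hM₀le, hne₀, -, hmin, hstruct⟩ :=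
    exists_minimal_kolyvaginClass_ne_zero hF W p h5 hsurj K hK h3 h4 hpd hpN hH Dt β ι n₁ d₁ 1 hΛ₁
      le_rfl hlev₁ hne₁
  -- Kummer on `E` (`s = rank + t_p = 2`) and on the twist (`rank' ≤ s' ≤ 1`)
  have hid : W.selmerCorank p = W.mordellWeilRank + W.shaCorank p :=
    W.selmerCorank_eq_mordellWeilRank_add_holds p
  have hdK : (NumberField.discr K : ℚ) ≠ 0 := by exact_mod_cast NumberField.discr_ne_zero K
  haveI := W.isElliptic_quadraticTwist hdK
  have hid' := (W.quadraticTwist (NumberField.discr K : ℚ)).selmerCorank_eq_mordellWeilRank_add_holds p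
  have hν : n₀.primeFactors.card = 1 := by
    rcases hstruct with ⟨h1, -, -⟩ | ⟨h2, h2', -⟩ <;> omega
  have hprime : n₀.Prime := prime_of_squarefree_of_card_primeFactors_eq_one hΛ₀.1 hν
  refine ⟨Dt, β, ι, n₀, d₀, M₀, hprime, ?_, hM₀, hM₀le, hne₀, ?_, by omega⟩
  · exact hΛ₀.2 n₀ (Nat.mem_primeFactors.mpr ⟨hprime, dvd_rfl, hprime.ne_zero⟩)
  · intro n' d' M' hΛ' hM' hM'le hne'
    rw [← hν]
    exact hmin n' d' M' hΛ' hM' hM'le hne'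

/-! ## §3 The same with `t_p = 0`, `rank = 2` read off a cell of the `p`-adic atlas -/

/-- **Row-specific λ-prediction from an atlas cell.** A curve `C` of the tree's `p`-adic atlas
passing its kernel test, a cell `c ∈ C.cells` (`p = c.p`), `W = C.e ⊗ ℚ`; the atlas binders (`hPRS`,
newform `hf`, Kato 17.4 `hkato`, rank certificate `hlow`, symbol DATA `D, hD, hint, htab`) give
`rank = 2 = s_p`, hence `t_p = 0`; with `ρ̄_{E,p}` onto, ♠, a Heegner field `K` (`d_K ∉ {−3,−4}`,
`p ∤ d_K`, any splitting of `p`) and the twist datum `s_p(E^{(d_K)}) ≤ 1`, §2 applies: FOR THIS `K`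
some Kolyvagin prime `ℓ` carries a non-zero class `c_M(ℓ)`, none sits at depth `0`, and
`rank E^{(d_K)} < rank E`. CONDITIONAL on `hZ`, `hF`, `hPRS`, `hkato`, the symbol data and the twist
datum; per-curve; BSD is not proved by it. [cite: WZhang2014, Thm. 1.1 (p. 195)]
[cite: Kolyvagin1991MathAnn, §2 Thm. 4] [cite: SteinWuthrich2013, Thm. 1.1 and §3]
[cite: MazurTateTeitelbaum1986Invent, §I.10–I.13] -/
theorem exists_kolyvaginPrime_class_ne_zero_at_of_atlasCell
    (hZ : WZhang2014_exists_kolyvaginClass_one_ne_zero)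
    (hF : Kolyvagin1991_selmerCorank_of_kolyvaginClass_ne_zero) (hPRS : Schneider1985_order_charGenerator)
    {C : AtlasCurve} (hC : C.check = true) {c : AtlasCell} (hc : c ∈ C.cells) [hp : Fact c.p.Prime]
    (W : WeierstrassCurve ℚ) [W.IsElliptic] [W.IsGloballyMinimal] (hW : W = C.e.baseChange ℚ)
    {N : ℕ} [NeZero N] {f : CuspForm (Gamma0 N) 2} (hf : IsNewformOf W f)
    (hkato : ∀ (κ : ZpExtension ℚ c.p) (γ : Field.absoluteGaloisGroup ℚ),
      kato_divisibility W c.p (κ := κ) (γ := γ) (f := f))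
    (hlow : 2 ≤ C.row.curve.mordellWeilRank) (D : ℚ) (hD : ‖(D : ℚ_[c.p])‖ = 1)
    (hint : ∀ x : ℚ, ‖(ratPlusSymbol f x : ℚ_[c.p])‖ ≤ 1)
    (htab : ∀ u : ℕ, u < c.p ^ (c.n + 1) → ¬ c.p ∣ u →
      ratPlusSymbol f ((u : ℚ) / (c.p : ℚ) ^ (c.n + 1)) = (c.tabHi.getD u 0 : ℚ) / D ∧
      ratPlusSymbol f ((u : ℚ) / (c.p : ℚ) ^ c.n) = (c.tabLo.getD (u % c.p ^ c.n) 0 : ℚ) / D)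
    (hsurj : W.HasSurjectiveModNGaloisRep c.p)
    (hram : ∀ (ℓ : ℕ) [Fact ℓ.Prime], W.HasMultiplicativeReductionAtPrime ℓ →
      ¬ c.p ∣ padicValInt ℓ W.minimalDiscriminantInt)
    (hss : ¬ W.IsSemistable ℤ → ∃ (ℓ₁ ℓ₂ : ℕ) (_ : Fact ℓ₁.Prime) (_ : Fact ℓ₂.Prime), ℓ₁ ≠ ℓ₂ ∧
      W.HasMultiplicativeReductionAtPrime ℓ₁ ∧ W.HasMultiplicativeReductionAtPrime ℓ₂)
    (K : Type) [Field K] [NumberField K] (hK : IsImaginaryQuadratic K)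
    (h3 : NumberField.discr K ≠ -3) (h4 : NumberField.discr K ≠ -4)
    (hpd : ¬ ((c.p : ℤ) ∣ NumberField.discr K)) [NeZero (W.conductorNorm ℤ)]
    (hH : SatisfiesHeegnerHypothesis (W.conductorNorm ℤ) K)
    (hc' : (W.quadraticTwist (NumberField.discr K : ℚ)).selmerCorank c.p ≤ 1) :
    ∃ (Dt : ModularParametrizationData W (W.conductorNorm ℤ)) (β : ℤ) (ι : K →+* ℂ) (ℓ : ℕ)
      (d : KolyvaginHeegnerData Dt β ι ℓ) (M : ℕ),
      ℓ.Prime ∧ Zhang2014.IsKolyvaginPrime (W.conductorNorm ℤ) W K c.p ℓ ∧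
      1 ≤ M ∧ (M : ℕ∞) ≤ Zhang2014.levelIndex W c.p ℓ ∧ d.kolyvaginClass hp.out M ≠ 0 ∧
      (∀ (n' : ℕ) (d' : KolyvaginHeegnerData Dt β ι n') (M' : ℕ),
        KolyvaginDescent.KolSupp (Zhang2014.IsKolyvaginPrime (W.conductorNorm ℤ) W K c.p) n' →
        1 ≤ M' → (M' : ℕ∞) ≤ Zhang2014.levelIndex W c.p n' → d'.kolyvaginClass hp.out M' ≠ 0 →
        1 ≤ n'.primeFactors.card) ∧
      (W.quadraticTwist (NumberField.discr K : ℚ)).mordellWeilRank < W.mordellWeilRank := by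
  subst hW
  have hk : c.check C.e = true := AtlasCurve.cell_check hC hc
  have h5 : 5 ≤ c.p := AtlasCell.five_le_of_check hk
  obtain ⟨hgood, hord⟩ := AtlasCell.isOrdinaryAt_of_check hk
  obtain ⟨hr2, -, -, -, hsel⟩ := AtlasCurve.padicRow hC hc hPRS hf hkato hlow D hD hint htab
  have hr2' : (C.e.baseChange ℚ).mordellWeilRank = 2 := by rw [AtlasCurve.baseChange_e]; exact hr2
  have hid : (C.e.baseChange ℚ).selmerCorank c.p =
      (C.e.baseChange ℚ).mordellWeilRank + (C.e.baseChange ℚ).shaCorank c.p :=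
    (C.e.baseChange ℚ).selmerCorank_eq_mordellWeilRank_add_holds c.p
  have ht : (C.e.baseChange ℚ).shaCorank c.p = 0 := by omega
  exact exists_kolyvaginPrime_class_ne_zero_at_of_shaCorank_eq_zero hZ hF _ hr2' c.p h5 hgood hord
    hsurj hram hss K hK h3 h4 hpd hH hc' ht


/-! ## §4 Hypothesis ♠ at `p = 5` for `389a1` (the other 14 semistable rows: sequel file
`KolyvaginDepthDoorDepthTableLambdaRowPredictionSpade`) -/

namespace C389a1

/-- **Hypothesis ♠ for `389a1` at `p = 5`**: `|Δ_min| = 389` (exponent `1`), so every multiplicative `ℓ` has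
`5 ∤ v_ℓ(Δ_min)` (♠(1)); `gcd(c₄, Δ) = 1`, so the curve is semistable (♠(2) vacuous). Kernel-decided
on the integer model. [cite: WZhang2014, Hypothesis ♠ (pp. 194–195)] [cite: CremonaAlgorithms1997, Table 1 (389a1)] -/
theorem spade_5 :
    haveI := curve389a1_isGloballyMinimal;
    (∀ (ℓ : ℕ) [Fact ℓ.Prime], Curve389a1.E.HasMultiplicativeReductionAtPrime ℓ →
      ¬ 5 ∣ padicValInt ℓ Curve389a1.E.minimalDiscriminantInt) ∧
      Curve389a1.E.IsSemistable ℤ := by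
  haveI := curve389a1_isGloballyMinimal
  haveI := Fact.mk (by norm_num : Nat.Prime 5)
  exact ⟨not_dvd_padicValInt_of_intModel intModel 5
      (forall_prime_dvd_of_natAbs_eq_pow (a := 389) (i := 1) (by decide +kernel) (by norm_num)
        ⟨1, by decide +kernel, by decide +kernel, by norm_num⟩),
    isSemistable_int_of_intModel_of_isCoprime intModel
      (by rw [Int.isCoprime_iff_gcd_eq_one]; decide +kernel)⟩

end C389a1

/-! ## §5 Showcase: the row-specific prediction at `(389a1, 5, d_K = −7)` -/

namespace C389a1

/-- **ROW `389a1`, `(p, d_K) = (5, −7)` — the field of g2's `depthRow_5_neg7_19`: the cyclotomic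
certificate predicts a non-zero class at SOME Kolyvagin prime `ℓ` FOR `ℚ(√−7)`.** For the cell
`c ∈ c389a1.cells` with `c.p = 5` and any imaginary quadratic `K` with `d_K = −7`: GIVEN the twist
datum `s_5(E^{(−7)}) ≤ 1` (through GZK: `ord_{s=1} L(E^{(−7)}, s) ≤ 1` — the depth table's own
field-selection criterion, a HYPOTHESIS here), the named facts `hZ` (W. Zhang 2014 Thm. 1.1), `hF`
(Kolyvagin 1991 Thm. 4), `hPRS`, the newform `hf`, Kato 17.4 `hkato` and the symbol DATA, there are a
frame, a Kolyvagin prime `ℓ` for `(389a1, ℚ(√−7), 5)` (`5` is INERT in `ℚ(√−7)` — outside BCGS's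
letter, inside Zhang's), a level `M ≤ M(ℓ)` and a datum with `c_M(ℓ) ≠ 0`; no non-zero class at depth
`0`; `rank E^{(−7)} < rank E`. Side conditions (`ρ̄_{E,5}` onto, ♠, Heegner for `(389, −7)`,
`2 ≤ rank`) are kernel theorems. CONDITIONAL as stated; per-curve; BSD is not proved by it.
[cite: WZhang2014, Thm. 1.1 (p. 195)] [cite: Kolyvagin1991MathAnn, §2 Thm. 4]
[cite: SteinWuthrich2013, Thm. 1.1 and §3] [cite: CremonaAlgorithms1997, Table 1 (389a1)] -/
theorem exists_kolyvaginPrime_class_ne_zero_of_lambda_at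
    (hZ : WZhang2014_exists_kolyvaginClass_one_ne_zero)
    (hF : Kolyvagin1991_selmerCorank_of_kolyvaginClass_ne_zero) (hPRS : Schneider1985_order_charGenerator)
    (K : Type) [Field K] [NumberField K] (hK : IsImaginaryQuadratic K) (hD : NumberField.discr K = -7)
    {c : AtlasCell} (hc : c ∈ c389a1.cells) (hc5 : c.p = 5) :
    haveI := curve389a1_isGloballyMinimal;
    haveI := curve389a1_neZero_conductorNorm;
    (Curve389a1.E.quadraticTwist ((-7 : ℤ) : ℚ)).selmerCorank 5 ≤ 1 →
    ∀ {N : ℕ} [NeZero N] {f : CuspForm (Gamma0 N) 2} (_hf : IsNewformOf Curve389a1.E f)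
    (_hkato : ∀ (κ : ZpExtension ℚ 5) (γ : Field.absoluteGaloisGroup ℚ),
      kato_divisibility Curve389a1.E 5 (κ := κ) (γ := γ) (f := f))
    (D : ℚ) (_hD : ‖(D : ℚ_[5])‖ = 1) (_hint : ∀ x : ℚ, ‖(ratPlusSymbol f x : ℚ_[5])‖ ≤ 1)
    (_htab : ∀ u : ℕ, u < 5 ^ (c.n + 1) → ¬ 5 ∣ u →
      ratPlusSymbol f ((u : ℚ) / (5 : ℚ) ^ (c.n + 1)) = (c.tabHi.getD u 0 : ℚ) / D ∧
      ratPlusSymbol f ((u : ℚ) / (5 : ℚ) ^ c.n) = (c.tabLo.getD (u % 5 ^ c.n) 0 : ℚ) / D),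
    ∃ (Dt : ModularParametrizationData Curve389a1.E (Curve389a1.E.conductorNorm ℤ)) (β : ℤ) (ι : K →+* ℂ)
      (ℓ : ℕ) (d : KolyvaginHeegnerData Dt β ι ℓ) (M : ℕ),
      ℓ.Prime ∧ Zhang2014.IsKolyvaginPrime (Curve389a1.E.conductorNorm ℤ) Curve389a1.E K 5 ℓ ∧
      1 ≤ M ∧ (M : ℕ∞) ≤ Zhang2014.levelIndex Curve389a1.E 5 ℓ ∧
      d.kolyvaginClass (p := 5) (by norm_num) M ≠ 0 ∧
      (∀ (n' : ℕ) (d' : KolyvaginHeegnerData Dt β ι n') (M' : ℕ),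
        KolyvaginDescent.KolSupp (Zhang2014.IsKolyvaginPrime (Curve389a1.E.conductorNorm ℤ)
          Curve389a1.E K 5) n' → 1 ≤ M' → (M' : ℕ∞) ≤ Zhang2014.levelIndex Curve389a1.E 5 n' →
        d'.kolyvaginClass (p := 5) (by norm_num) M' ≠ 0 → 1 ≤ n'.primeFactors.card) ∧
      (Curve389a1.E.quadraticTwist (NumberField.discr K : ℚ)).mordellWeilRank <
        Curve389a1.E.mordellWeilRank := by
  haveI := curve389a1_isGloballyMinimal
  haveI := curve389a1_neZero_conductorNorm
  intro hc' N _ f hf hkato D hD' hint htab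
  have hC : c389a1.check = true :=
    (AtlasCurve.check_of_all atlasR2A00_check (by simp [atlasR2A00])).1
  have hH : SatisfiesHeegnerHypothesis (Curve389a1.E.conductorNorm ℤ) K :=
    satisfiesHeegnerHypothesis_conductorNorm_of_intModel intModel K hK.1 hD heegner_neg7
  have hc'' : (Curve389a1.E.quadraticTwist (NumberField.discr K : ℚ)).selmerCorank 5 ≤ 1 := by
    rw [hD]; exact hc'
  -- free the cell's prime so that `c.p = 5` can be substituted
  obtain ⟨p', ap, n, A, tHi, tLo, H, L⟩ := c
  dsimp only at hc5
  subst hc5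
  exact exists_kolyvaginPrime_class_ne_zero_at_of_atlasCell hZ hF hPRS hC hc (hp := ⟨by norm_num⟩)
    Curve389a1.E curve_eq_atlas hf hkato Curve389a1.two_le_mordellWeilRank_row D hD' hint htab
    hasSurjectiveModNGaloisRep_5 spade_5.1 (fun h ↦ absurd spade_5.2 h) K hK (by rw [hD]; norm_num)
    (by rw [hD]; norm_num) (by rw [hD]; norm_num) hH hc''

end C389a1

end Summit.BirchSwinnertonDyer.BirchSwinnertonDyer.Theorems.KolyvaginDepthDoor

end
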